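import Mathlib
import Summits.NavierStokesRegularity.NavierStokesRegularity.Theses.RellichScar
import Summits.NavierStokesRegularity.NavierStokesRegularity.Theorems.RellichScarDefs
import Summits.NavierStokesRegularity.NavierStokesRegularity.Theorems.ScarRigidity.Negative.LogicAndLoadBearing
import Literature.Analysis.FluidPDE.TypeIAncientMild
import HarnessLib

/-!
# `ScarRigidity`, line `moment-conditioned-rellich`, stub `stub_higherMomentsVanish` —
# the integrability conjunct of `RadiativeMomentsVanish`

Support file (everything proved) for the stub `stub_higherMomentsVanish` (rungs `ℓ ≥ 3` of the painted
ladder) of crux stmt-NavierStokesRegularity-11717 (route RellichScar).  `RadiativeMomentsVanish ℓ V₁ V₂` is a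
conjunction: for every solid harmonic `H` of degree `ℓ` and every `t < 0`, (i) the moment integrand
`Σᵢⱼ ((V₁)ᵢ(V₁)ⱼ − (V₂)ᵢ(V₂)ⱼ)(t,x) ∂ᵢ∂ⱼH(x)` is integrable on `ℝ³` and (ii) its integral vanishes.  Conjunct (i)
is proved here from flatness of order `N > ℓ` on the parabolic exterior (`FarDecay N`), the apex bounds
`‖Vₖ(t,x)‖ ≤ C/(‖x‖+√(−t))` and continuity of the slices:

* the Hessian of a smooth function which is positively homogeneous of degree `ℓ ≥ 2` is positively homogeneous
  of degree `ℓ − 2` (chain rule for `x ↦ r • x`), hence `‖D²H(x)‖ ≤ M ‖x‖^{ℓ−2}` with `M = max_{‖u‖=1} ‖D²H(u)‖`;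
* on `√(−t) ≤ ‖x‖` the Reynolds-stress defect is `≤ 2C·K(√(−t))^ℓ/‖x‖^{ℓ+2}` entrywise (flatness at order `0`,
  `(√(−t)/‖x‖)^N ≤ (√(−t)/‖x‖)^{ℓ+1}`), so the integrand is `O(‖x‖⁻⁴)`, dominated by a multiple of `(1+‖x‖)⁻⁴`,
  which is integrable on `ℝ³` (Mathlib's `integrable_one_add_norm`, `3 < 4`);
* on the closed ball `‖x‖ ≤ √(−t)` the integrand is continuous, hence integrable.

Conjunct (ii) (the vanishing) is NOT touched: no mechanism is known for `ℓ ≥ 2` (see the lead's skeleton).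
-/

noncomputable section

open Set Filter Function MeasureTheory Metric TopologicalSpace
open scoped Topology ENNReal NNReal InnerProductSpace RealInnerProductSpace Laplacian
open Literature.Analysis.FluidPDE
open Summit.NavierStokesRegularity.NavierStokesRegularity.Theses.RellichScar
open Summit.NavierStokesRegularity.NavierStokesRegularity.Theorems.ScarRigidity.Negative

set_option linter.dupNamespace false

namespace Summit.NavierStokesRegularity.NavierStokesRegularity.Theorems.RellichScarScarRigidity

/-- Physical space. -/
local notation "ℝ³" => EuclideanSpace ℝ (Fin 3)

/-! ## The Hessian of a positively homogeneous smooth function -/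

/-- Chain rule for dilations: for a smooth `H` which is positively homogeneous of degree `ℓ`,
`r² · D²H(r • x) = rˡ · D²H(x)` for every `r > 0`. [folklore] -/
theorem iteratedFDeriv_two_smul_of_homogeneous {ℓ : ℕ} {H : ℝ³ → ℝ} (hH : ContDiff ℝ (⊤ : ℕ∞) H)
    (hhom : ∀ (r : ℝ) (x : ℝ³), 0 < r → H (r • x) = r ^ ℓ * H x) {r : ℝ} (hr : 0 < r) (x : ℝ³) :
    r ^ 2 • iteratedFDeriv ℝ 2 H (r • x) = r ^ ℓ • iteratedFDeriv ℝ 2 H x := by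
  have h2 : ContDiff ℝ ((2 : ℕ) : WithTop ℕ∞) H := contDiff_infty.1 hH 2
  have hfun : (fun z : ℝ³ => H (r • z)) = fun z => r ^ ℓ • H z := by
    funext z
    rw [hhom r z hr, smul_eq_mul]
  have hL := congrFun (iteratedFDeriv_comp_const_smul (i := 2) r h2) x
  rw [hfun, iteratedFDeriv_const_smul_apply' h2.contDiffAt] at hL
  exact hL.symm

/-- The Hessian of a smooth function which is positively homogeneous of degree `ℓ ≥ 2` grows at most like
`‖x‖^{ℓ−2}`: `‖D²H(x)‖ ≤ M ‖x‖^{ℓ−2}` for `x ≠ 0`, with `M ≥ 0` the maximum of `‖D²H‖` on the unit sphere. [folklore] -/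
theorem exists_norm_iteratedFDeriv_two_le {ℓ : ℕ} {H : ℝ³ → ℝ} (hℓ : 2 ≤ ℓ)
    (hH : ContDiff ℝ (⊤ : ℕ∞) H) (hhom : ∀ (r : ℝ) (x : ℝ³), 0 < r → H (r • x) = r ^ ℓ * H x) :
    ∃ M : ℝ, 0 ≤ M ∧ ∀ x : ℝ³, x ≠ 0 → ‖iteratedFDeriv ℝ 2 H x‖ ≤ M * ‖x‖ ^ (ℓ - 2) := by
  have hcont : Continuous (iteratedFDeriv ℝ 2 H) :=
    (contDiff_infty.1 hH 2).continuous_iteratedFDeriv le_rfl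
  obtain ⟨M, hM⟩ :=
    (isCompact_sphere (0 : ℝ³) 1).exists_bound_of_continuousOn hcont.continuousOn
  refine ⟨max M 0, le_max_right _ _, fun x hx => ?_⟩
  have hr : 0 < ‖x‖ := norm_pos_iff.2 hx
  set u : ℝ³ := ‖x‖⁻¹ • x with hu
  have hu1 : u ∈ sphere (0 : ℝ³) 1 := by
    rw [mem_sphere_zero_iff_norm, hu, norm_smul, norm_inv, norm_norm, inv_mul_cancel₀ hr.ne']
  have hxu : ‖x‖ • u = x := by
    rw [hu, smul_smul, mul_inv_cancel₀ hr.ne', one_smul]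
  have hscale := iteratedFDeriv_two_smul_of_homogeneous hH hhom hr u
  rw [hxu] at hscale
  -- `‖x‖² • D²H(x) = ‖x‖ˡ • D²H(u)`
  have h2ne : ‖x‖ ^ 2 ≠ 0 := pow_ne_zero _ hr.ne'
  have hpow : ‖x‖ ^ ℓ = ‖x‖ ^ 2 * ‖x‖ ^ (ℓ - 2) := by
    rw [← pow_add, Nat.add_sub_cancel' hℓ]
  have hD : iteratedFDeriv ℝ 2 H x = ‖x‖ ^ (ℓ - 2) • iteratedFDeriv ℝ 2 H u := by
    have h := congrArg (fun T => (‖x‖ ^ 2)⁻¹ • T) hscale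
    simp only [smul_smul, inv_mul_cancel₀ h2ne, one_smul] at h
    rw [h, hpow, ← mul_assoc, inv_mul_cancel₀ h2ne, one_mul]
  rw [hD, norm_smul, norm_pow, norm_norm, mul_comm]
  exact mul_le_mul_of_nonneg_right ((hM u hu1).trans (le_max_left _ _)) (pow_nonneg hr.le _)

/-- A Hessian entry `D²H(x)(eᵢ, eⱼ)` is bounded by the operator norm of `D²H(x)` (`‖eᵢ‖ = 1`). [folklore] -/
theorem abs_iteratedFDeriv_two_apply_single_le (H : ℝ³ → ℝ) (x : ℝ³) (i j : Fin 3) :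
    |iteratedFDeriv ℝ 2 H x ![EuclideanSpace.single i (1 : ℝ), EuclideanSpace.single j (1 : ℝ)]| ≤
      ‖iteratedFDeriv ℝ 2 H x‖ := by
  have hm : ‖(![EuclideanSpace.single i (1 : ℝ), EuclideanSpace.single j (1 : ℝ)] : Fin 2 → ℝ³)‖ ≤ 1 := by
    refine (pi_norm_le_iff_of_nonneg zero_le_one).2 fun k => ?_
    fin_cases k <;> simp
  have h := (iteratedFDeriv ℝ 2 H x).le_opNorm_mul_pow_of_le hm
  rw [one_pow, mul_one] at h
  rwa [← Real.norm_eq_abs]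

/-! ## Pointwise facts about the moment integrand -/

/-- Entrywise bound for the Reynolds-stress defect: `|aᵢaⱼ − bᵢbⱼ| ≤ ‖a − b‖‖a‖ + ‖b‖‖a − b‖`
(`aᵢaⱼ − bᵢbⱼ = (a − b)ᵢaⱼ + bᵢ(a − b)ⱼ` and `|vᵢ| ≤ ‖v‖`). [folklore] -/
theorem abs_mul_sub_mul_apply_le (a b : ℝ³) (i j : Fin 3) :
    |a i * a j - b i * b j| ≤ ‖a - b‖ * ‖a‖ + ‖b‖ * ‖a - b‖ := by
  have h : a i * a j - b i * b j = (a - b) i * a j + b i * (a - b) j := by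
    simp only [PiLp.sub_apply]; ring
  rw [h]
  have key : ∀ (v : ℝ³) (k : Fin 3), |v k| ≤ ‖v‖ := fun v k => by
    rw [← Real.norm_eq_abs]; exact PiLp.norm_apply_le v k
  refine (abs_add_le _ _).trans (add_le_add ?_ ?_)
  · rw [abs_mul]
    exact mul_le_mul (key _ _) (key _ _) (abs_nonneg _) (norm_nonneg _)
  · rw [abs_mul]
    exact mul_le_mul (key _ _) (key _ _) (abs_nonneg _) (norm_nonneg _)

/-- The moment integrand of continuous slices against a smooth `H` is continuous. [folklore] -/
theorem continuous_momentIntegrand {H : ℝ³ → ℝ} {V₁ V₂ : ℝ → ℝ³ → ℝ³} {t : ℝ}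
    (hH : ContDiff ℝ (⊤ : ℕ∞) H) (h₁ : Continuous (V₁ t)) (h₂ : Continuous (V₂ t)) :
    Continuous (momentIntegrand H V₁ V₂ t) := by
  have hD : Continuous (iteratedFDeriv ℝ 2 H) :=
    (contDiff_infty.1 hH 2).continuous_iteratedFDeriv le_rfl
  unfold momentIntegrand
  refine continuous_finsetSum _ fun i _ => continuous_finsetSum _ fun j _ => ?_
  have h1i : Continuous fun x => (V₁ t x) i := (PiLp.continuous_apply _ _ i).comp h₁
  have h1j : Continuous fun x => (V₁ t x) j := (PiLp.continuous_apply _ _ j).comp h₁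
  have h2i : Continuous fun x => (V₂ t x) i := (PiLp.continuous_apply _ _ i).comp h₂
  have h2j : Continuous fun x => (V₂ t x) j := (PiLp.continuous_apply _ _ j).comp h₂
  exact ((h1i.mul h1j).sub (h2i.mul h2j)).mul ((continuous_eval_const _).comp hD)

/-- `(1 + ‖x‖)⁻⁴` is integrable on `ℝ³` (Mathlib's `integrable_one_add_norm`, `3 < 4`). [folklore] -/
theorem integrable_one_add_norm_pow_four_inv :
    Integrable (fun y : ℝ³ => ((1 + ‖y‖) ^ 4)⁻¹) volume := by
  have h : Integrable (fun y : ℝ³ => (1 + ‖y‖) ^ (-(4 : ℝ))) volume :=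
    integrable_one_add_norm (by rw [finrank_euclideanSpace_fin]; norm_num)
  refine h.congr (Eventually.of_forall fun y => ?_)
  show (1 + ‖y‖) ^ (-(4 : ℝ)) = ((1 + ‖y‖) ^ 4)⁻¹
  rw [Real.rpow_neg (by positivity), ← Real.rpow_natCast]
  norm_num

/-! ## Integrability of the moment integrand -/

/-- **Absolute convergence of the radiative moments.**  If the slices `V₁(t)`, `V₂(t)` are continuous and obey
the apex bound `‖Vₖ(t,x)‖ ≤ C/(‖x‖+√(−t))`, the pair is flat of order `N` on the parabolic exterior and `H` is a
solid harmonic of degree `ℓ` with `2 ≤ ℓ < N`, then `x ↦ Σᵢⱼ((V₁)ᵢ(V₁)ⱼ − (V₂)ᵢ(V₂)ⱼ)(t,x)∂ᵢ∂ⱼH(x)` is integrable on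
`ℝ³` for `t < 0`: it is continuous, and `O(‖x‖^{ℓ−2} · ‖x‖^{−ℓ−1} · ‖x‖⁻¹) = O(‖x‖⁻⁴)` on `√(−t) ≤ ‖x‖`. [folklore] -/
theorem integrable_momentIntegrand {ℓ N : ℕ} {H : ℝ³ → ℝ} {V₁ V₂ : ℝ → ℝ³ → ℝ³} {C t : ℝ}
    (hℓ : 2 ≤ ℓ) (hN : ℓ < N) (hH : IsSolidHarmonic ℓ H) (ht : t < 0)
    (h₁ : Continuous (V₁ t)) (h₂ : Continuous (V₂ t))
    (hd₁ : HasTypeIDecay C V₁) (hd₂ : HasTypeIDecay C V₂) (hF : FarDecay N V₁ V₂) :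
    Integrable (momentIntegrand H V₁ V₂ t) volume := by
  set s : ℝ := Real.sqrt (-t) with hs_def
  have hs : 0 < s := Real.sqrt_pos.2 (by linarith)
  have hcont : Continuous (momentIntegrand H V₁ V₂ t) := continuous_momentIntegrand hH.1 h₁ h₂
  -- `0 ≤ C` (the apex bound at `x = 0`)
  have hC : 0 ≤ C := by
    refine le_of_not_gt fun hneg => ?_
    have h0 := hd₁ t ht 0
    have hden : 0 < ‖(0 : ℝ³)‖ + Real.sqrt (-t) := by rw [norm_zero, zero_add]; exact hs
    have : C / (‖(0 : ℝ³)‖ + Real.sqrt (-t)) < 0 := div_neg_of_neg_of_pos hneg hden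
    linarith [norm_nonneg (V₁ t 0)]
  -- split `ℝ³` into the closed ball of radius `√(−t)` and its complement
  rw [← integrableOn_univ, ← union_compl_self (closedBall (0 : ℝ³) s), integrableOn_union]
  refine ⟨hcont.continuousOn.integrableOn_compact (isCompact_closedBall _ _), ?_⟩
  obtain ⟨M, hM0, hM⟩ := exists_norm_iteratedFDeriv_two_le hℓ hH.1 hH.2.1
  obtain ⟨K, hK⟩ := hF 0
  set K' : ℝ := max K 0 with hK'_def
  have hK'0 : 0 ≤ K' := le_max_right _ _
  set B : ℝ := 2 * C * (K' * s ^ ℓ) * M with hB_def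
  have hB0 : 0 ≤ B := by positivity
  set A : ℝ := 9 * B * (1 + s⁻¹) ^ 4 with hA_def
  have hg : Integrable (fun y : ℝ³ => A * ((1 + ‖y‖) ^ 4)⁻¹) volume :=
    integrable_one_add_norm_pow_four_inv.const_mul A
  refine hg.integrableOn.mono' hcont.aestronglyMeasurable ?_
  rw [ae_restrict_iff' measurableSet_closedBall.compl]
  refine Eventually.of_forall fun x hx => ?_
  simp only [mem_compl_iff, mem_closedBall, dist_zero_right, not_le] at hx
  -- now `s < ‖x‖`; write `r = ‖x‖`
  set r : ℝ := ‖x‖ with hr_def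
  have hsr : s ≤ r := hx.le
  have hr : 0 < r := hs.trans hx
  have hr0 : r ≠ 0 := hr.ne'
  have hx0 : x ≠ 0 := by
    intro h; rw [h, norm_zero] at hr_def; exact hr0 hr_def
  -- flatness at order zero: `‖V₁ − V₂‖ ≤ K' sˡ / r^{ℓ+1}`
  have hw : ‖V₁ t x - V₂ t x‖ ≤ K' * s ^ ℓ / r ^ (ℓ + 1) := by
    have h0 := hK t ht x hsr
    rw [norm_iteratedFDeriv_zero, pow_zero, div_one] at h0
    have hq0 : 0 ≤ s / r := div_nonneg hs.le hr.le
    have hq1 : s / r ≤ 1 := (div_le_one hr).2 hsr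
    calc ‖V₁ t x - V₂ t x‖ ≤ K * s⁻¹ * (s / r) ^ N := h0
      _ ≤ K' * s⁻¹ * (s / r) ^ N := by gcongr; exact le_max_left _ _
      _ ≤ K' * s⁻¹ * (s / r) ^ (ℓ + 1) :=
          mul_le_mul_of_nonneg_left (pow_le_pow_of_le_one hq0 hq1 (by omega)) (by positivity)
      _ = K' * s ^ ℓ / r ^ (ℓ + 1) := by
          rw [div_pow]; field_simp; ring
  -- apex bounds: `‖Vₖ‖ ≤ C / r`
  have hV₁ : ‖V₁ t x‖ ≤ C / r :=
    (hd₁ t ht x).trans (div_le_div_of_nonneg_left hC hr (le_add_of_nonneg_right hs.le))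
  have hV₂ : ‖V₂ t x‖ ≤ C / r :=
    (hd₂ t ht x).trans (div_le_div_of_nonneg_left hC hr (le_add_of_nonneg_right hs.le))
  -- entrywise defect bound
  have ha : ∀ i j : Fin 3,
      |(V₁ t x) i * (V₁ t x) j - (V₂ t x) i * (V₂ t x) j| ≤ 2 * C * (K' * s ^ ℓ) / r ^ (ℓ + 2) := by
    intro i j
    refine (abs_mul_sub_mul_apply_le _ _ i j).trans ?_
    calc ‖V₁ t x - V₂ t x‖ * ‖V₁ t x‖ + ‖V₂ t x‖ * ‖V₁ t x - V₂ t x‖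
        ≤ (K' * s ^ ℓ / r ^ (ℓ + 1)) * (C / r) + (C / r) * (K' * s ^ ℓ / r ^ (ℓ + 1)) := by
          gcongr ?_ * ?_ + ?_ * ?_
      _ = 2 * C * (K' * s ^ ℓ) / r ^ (ℓ + 2) := by
          rw [pow_succ]; field_simp; ring
  -- Hessian entries
  have hb : ∀ i j : Fin 3,
      |iteratedFDeriv ℝ 2 H x ![EuclideanSpace.single i (1 : ℝ), EuclideanSpace.single j (1 : ℝ)]| ≤
        M * r ^ (ℓ - 2) :=
    fun i j => (abs_iteratedFDeriv_two_apply_single_le H x i j).trans (hM x hx0)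
  -- each of the nine terms is `≤ B / r⁴`
  have hab : ∀ i j : Fin 3,
      |((V₁ t x) i * (V₁ t x) j - (V₂ t x) i * (V₂ t x) j) *
          iteratedFDeriv ℝ 2 H x ![EuclideanSpace.single i (1 : ℝ), EuclideanSpace.single j (1 : ℝ)]| ≤
        B / r ^ 4 := by
    intro i j
    rw [abs_mul]
    calc _ ≤ (2 * C * (K' * s ^ ℓ) / r ^ (ℓ + 2)) * (M * r ^ (ℓ - 2)) :=
          mul_le_mul (ha i j) (hb i j) (abs_nonneg _) (by positivity)
      _ = B / r ^ 4 := by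
          have hr4 : r ^ (ℓ + 2) = r ^ (ℓ - 2) * r ^ 4 := by
            rw [← pow_add]; congr 1; omega
          rw [hr4, hB_def]
          field_simp
  have hsum : |momentIntegrand H V₁ V₂ t x| ≤ 9 * (B / r ^ 4) := by
    unfold momentIntegrand
    refine (Finset.abs_sum_le_sum_abs _ _).trans ?_
    refine (Finset.sum_le_sum fun i _ => Finset.abs_sum_le_sum_abs _ _).trans ?_
    refine (Finset.sum_le_sum fun i _ => Finset.sum_le_sum fun j _ => hab i j).trans ?_
    simp only [Finset.sum_const, Finset.card_univ, Fintype.card_fin, nsmul_eq_mul, Nat.cast_ofNat]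
    linarith
  -- `1/r⁴ ≤ (1 + 1/s)⁴ (1 + r)⁻⁴` on `s ≤ r`
  have hkey : (r ^ 4)⁻¹ ≤ (1 + s⁻¹) ^ 4 * ((1 + r) ^ 4)⁻¹ := by
    have hinv : r⁻¹ ≤ s⁻¹ := inv_anti₀ hs hsr
    have h1 : r⁻¹ ≤ (1 + s⁻¹) * (1 + r)⁻¹ := by
      rw [← div_eq_mul_inv, le_div_iff₀ (by positivity : (0 : ℝ) < 1 + r), mul_add, mul_one,
        inv_mul_cancel₀ hr0]
      linarith
    rw [← inv_pow, ← inv_pow, ← mul_pow]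
    exact pow_le_pow_left₀ (inv_nonneg.2 hr.le) h1 4
  calc ‖momentIntegrand H V₁ V₂ t x‖ = |momentIntegrand H V₁ V₂ t x| := Real.norm_eq_abs _
    _ ≤ 9 * (B / r ^ 4) := hsum
    _ = 9 * B * (r ^ 4)⁻¹ := by ring
    _ ≤ 9 * B * ((1 + s⁻¹) ^ 4 * ((1 + r) ^ 4)⁻¹) := by gcongr
    _ = A * ((1 + r) ^ 4)⁻¹ := by rw [hA_def]; ring

/-- **The integrability conjunct of `RadiativeMomentsVanish ℓ` for rung `ℓ` of the ladder** (the setting of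
`stub_higherMomentsVanish` / `stub_quadrupoleDefectVanishes`): for two Type-I ancient mild fields with the apex
bound at the same constant which are flat of order `ℓ + 2` on the parabolic exterior, and every solid harmonic
`H` of degree `ℓ ≥ 2`, the degree-`ℓ` moment integrand is integrable at every negative time
(`‖x‖^{ℓ−2}·(√(−t))ˡ‖x‖^{−ℓ−1}·‖x‖⁻¹ = O(‖x‖⁻⁴)`). [folklore] -/
theorem integrable_momentIntegrand_of_farDecay (V₁ V₂ : ℝ → ℝ³ → ℝ³) (C : ℝ) (ℓ : ℕ) (hℓ : 2 ≤ ℓ)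
    (hm₁ : IsTypeIAncientMild C V₁) (hm₂ : IsTypeIAncientMild C V₂)
    (hd₁ : HasTypeIDecay C V₁) (hd₂ : HasTypeIDecay C V₂) (hF : FarDecay (ℓ + 2) V₁ V₂) :
    ∀ H : ℝ³ → ℝ, IsSolidHarmonic ℓ H → ∀ t < 0, Integrable (momentIntegrand H V₁ V₂ t) volume :=
  fun _ hH _ ht =>
    integrable_momentIntegrand hℓ (by omega) hH ht (hm₁.continuous_slice ht) (hm₂.continuous_slice ht)
      hd₁ hd₂ hF

/-- **Registered glue `stub_momentIntegrability` (conjunct 1 of `RadiativeMomentsVanish ℓ`, every rung `ℓ ≥ 2`).**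
For two Type-I ancient mild apex profiles with the apex bound, flatness of order `ℓ + 2` on the parabolic exterior makes
the degree-`ℓ` radiative moment integrand absolutely integrable at every negative time (arrow form of
`integrable_momentIntegrand_of_farDecay`; `ℓ = 2` is conjunct 1 of the quadrupole rung). [folklore] -/
theorem stub_momentIntegrability :
    ∀ (V₁ V₂ : ℝ → ℝ³ → ℝ³) (C : ℝ) (ℓ : ℕ), 2 ≤ ℓ →
      IsTypeIAncientMild C V₁ → IsTypeIAncientMild C V₂ → HasTypeIDecay C V₁ → HasTypeIDecay C V₂ →
      FarDecay (ℓ + 2) V₁ V₂ →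
      ∀ H : ℝ³ → ℝ, IsSolidHarmonic ℓ H → ∀ t < 0, Integrable (momentIntegrand H V₁ V₂ t) volume :=
  fun V₁ V₂ C ℓ hℓ hm₁ hm₂ hd₁ hd₂ hF =>
    integrable_momentIntegrand_of_farDecay V₁ V₂ C ℓ hℓ hm₁ hm₂ hd₁ hd₂ hF

end Summit.NavierStokesRegularity.NavierStokesRegularity.Theorems.RellichScarScarRigidity

end
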